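import Literature.AlgebraicGeometry.Resolution.LogChartEmbeddingRank
import Literature.Analysis.Convex.LinearProgrammingDuality
import HarnessLib

/-!
# Sharp finitely generated submonoids of `ℤⁿ` embed into `ℕ^M` (Gordan / Farkas)

`Literature/AlgebraicGeometry/Resolution/SharpMonoidEmbedding.lean`. In K. Kato, *Toric
singularities*, Amer. J. Math. 116 (1994), the sharp fs monoid `P̄ = M̄_{X,x}` at a point is
placed inside a free monoid `ℕ^r` ((9.8)/(10.4): the regular cone of a subdivision; (3.2): the
completed monoid ring `R[[P̄]]`). The existence of SOME injective monoid map `P̄ → ℕ^M` is the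
classical fact that a pointed rational polyhedral cone has a full-dimensional dual cone (Farkas'
lemma; Fulton, *Toric varieties*, §1.2 (Gordan's lemma and duality)). We PROVE it from the tree's
Farkas lemma over ordered fields (`Literature.Analysis.Convex.LPDuality.farkas_nonneg_eq`):

* `exists_nsmul_mem_of_forall_dotProduct_nonneg` — if every integral `u` with `u·vⱼ ≥ 0` on the
  generators has `u·w ≥ 0`, then `N w ∈ S` for some `N > 0`;
* `span_dualInt_eq_top` — for a sharp `S`, the integral dual vectors span `ℚⁿ`;
* `exists_embedding_of_sharp` — **∃ `e : ℤⁿ →+ ℤⁿ` injective with `e(S) ⊆ ℕⁿ`**;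
* `exists_isSharpEmbedding` — for a chart `P ⊆ ℤⁿ` (saturated) and a face `F`: a sharp embedding
  (`LogChart.IsSharpEmbedding`) exists; `exists_dformData_of_isLogRegularAt''` — the K2 interface
  theorem with no embedding hypothesis.

References: [Kato1994] K. Kato, Toric singularities, Amer. J. Math. 116 (1994), (1.6), (5.4), (9.8);
[Fulton1993Toric] W. Fulton, Introduction to Toric Varieties, §1.2.
-/

noncomputable section

open Matrix

namespace Literature.AlgebraicGeometry.Resolution

namespace LogChart

universe u

variable {n : ℕ}

/-! ### Clearing denominators -/

/-- A rational vector is `N⁻¹` times an integral one. [folklore] -/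
private theorem exists_int_mul (y : Fin n → ℚ) :
    ∃ N : ℕ, 0 < N ∧ ∃ u : Fin n → ℤ, ∀ i, (u i : ℚ) = N * y i := by
  refine ⟨∏ i, (y i).den, Finset.prod_pos fun i _ => (y i).den_pos, ?_⟩
  have h : ∀ i, ∃ z : ℤ, (z : ℚ) = (∏ j, (y j).den : ℕ) * y i := by
    intro i
    obtain ⟨c, hc⟩ : (y i).den ∣ ∏ j, (y j).den := Finset.dvd_prod_of_mem _ (Finset.mem_univ i)
    refine ⟨(y i).num * c, ?_⟩
    rw [hc]
    push_cast
    have := Rat.mul_den_eq_num (y i)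
    calc ((y i).num : ℚ) * c = (y i * (y i).den) * c := by rw [this]
      _ = ((y i).den * c : ℚ) * y i := by ring
  choose u hu using h
  exact ⟨u, hu⟩

/-- Coordinatewise cast `ℤⁿ → ℚⁿ`. [folklore] -/
private def qcast (v : Fin n → ℤ) : Fin n → ℚ := fun i => (v i : ℚ)

/-- The cast commutes with dot products. [folklore] -/
private theorem qcast_dotProduct (u v : Fin n → ℤ) : qcast u ⬝ᵥ qcast v = ((u ⬝ᵥ v : ℤ) : ℚ) := by
  simp only [dotProduct, qcast]; push_cast; rfl

/-! ### Farkas: membership in the monoid up to a multiple -/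

variable {k : ℕ} (v : Fin k → (Fin n → ℤ))

/-- The integral dual vectors of the generators. [cite: Kato1994, (5.4)] -/
def dualInt (v : Fin k → (Fin n → ℤ)) : Set (Fin n → ℤ) := {u | ∀ j, 0 ≤ u ⬝ᵥ v j}

/-- **Farkas for monoids.** If `w ∈ ℤⁿ` pairs non-negatively with every integral vector pairing
non-negatively with the generators `vⱼ`, then a positive multiple of `w` is an `ℕ`-combination of
the `vⱼ`. [cite: Fulton1993Toric, §1.2] -/
theorem exists_nsmul_mem_of_forall_dotProduct_nonneg {w : Fin n → ℤ}
    (hw : ∀ u ∈ dualInt v, 0 ≤ u ⬝ᵥ w) :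
    ∃ N : ℕ, 0 < N ∧ N • w ∈ AddSubmonoid.closure (Set.range v) := by
  classical
  -- Farkas over `ℚ` for the matrix with columns `vⱼ`
  let A : Matrix (Fin n) (Fin k) ℚ := fun i j => (v j i : ℚ)
  have hR : ∀ y : Fin n → ℚ, 0 ≤ y ᵥ* A → 0 ≤ y ⬝ᵥ qcast w := by
    intro y hy
    obtain ⟨N, hN, u, hu⟩ := exists_int_mul y
    have huA : u ∈ dualInt v := by
      intro j
      have h1 : 0 ≤ (y ᵥ* A) j := hy j
      have h2 : (y ᵥ* A) j = y ⬝ᵥ qcast (v j) := by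
        simp only [vecMul, dotProduct, A, qcast]
      have h3 : qcast u ⬝ᵥ qcast (v j) = N * (y ⬝ᵥ qcast (v j)) := by
        simp only [dotProduct, qcast, hu, Finset.mul_sum, mul_assoc]
      have h4 : (0 : ℚ) ≤ ((u ⬝ᵥ v j : ℤ) : ℚ) := by
        rw [← qcast_dotProduct, h3]; exact mul_nonneg (by positivity) (h2 ▸ h1)
      exact_mod_cast h4
    have h5 := hw u huA
    have h6 : qcast u ⬝ᵥ qcast w = N * (y ⬝ᵥ qcast w) := by
      simp only [dotProduct, qcast, hu, Finset.mul_sum, mul_assoc]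
    have h7 : (0 : ℚ) ≤ N * (y ⬝ᵥ qcast w) := by
      rw [← h6, qcast_dotProduct]; exact_mod_cast h5
    exact nonneg_of_mul_nonneg_right (by rwa [mul_comm] at h7) (by exact_mod_cast hN)
  obtain ⟨x, hx0, hx⟩ := (Literature.Analysis.Convex.LPDuality.farkas_nonneg_eq A (qcast w)).2 hR
  -- clear the denominators of `x`
  obtain ⟨N, hN, c, hc⟩ := exists_int_mul x
  have hc0 : ∀ j, 0 ≤ c j := fun j => by
    have : (0 : ℚ) ≤ c j := by rw [hc]; exact mul_nonneg (by positivity) (hx0 j)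
    exact_mod_cast this
  refine ⟨N, hN, ?_⟩
  have hsum : N • w = ∑ j, (c j).toNat • v j := by
    funext i
    have h1 : (A *ᵥ x) i = (w i : ℚ) := by rw [hx]; rfl
    simp only [mulVec, dotProduct, A] at h1
    have h2 : ((N • w) i : ℤ) = ∑ j, c j * v j i := by
      have : ((N : ℚ) * w i) = ∑ j, (c j : ℚ) * v j i := by
        rw [← h1, Finset.mul_sum]
        refine Finset.sum_congr rfl fun j _ => ?_
        rw [hc]; ring
      have : (((N : ℤ) * w i : ℤ) : ℚ) = ((∑ j, c j * v j i : ℤ) : ℚ) := by push_cast; exact this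
      rw [Pi.smul_apply, nsmul_eq_mul]
      exact_mod_cast this
    rw [h2, Finset.sum_apply]
    refine Finset.sum_congr rfl fun j _ => ?_
    rw [Pi.smul_apply, nsmul_eq_mul, Int.toNat_of_nonneg (hc0 j)]
  rw [hsum]
  exact AddSubmonoid.sum_mem _ fun j _ =>
    AddSubmonoid.nsmul_mem _ (AddSubmonoid.subset_closure (Set.mem_range_self j)) _

/-! ### Sharpness makes the integral dual span -/

/-- **A sharp monoid has a spanning integral dual**: if `S = ⟨v₁,…,v_k⟩ ⊆ ℤⁿ` has `S ∩ −S = 0`,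
then the rational span of `dualInt v` is all of `ℚⁿ`. [cite: Fulton1993Toric, §1.2] -/
theorem span_dualInt_eq_top
    (hsharp : ∀ s ∈ AddSubmonoid.closure (Set.range v), -s ∈ AddSubmonoid.closure (Set.range v) → s = 0) :
    Submodule.span ℚ (qcast '' dualInt v : Set (Fin n → ℚ)) = ⊤ := by
  classical
  by_contra hne
  have hlt : Submodule.span ℚ (qcast '' dualInt v : Set (Fin n → ℚ)) < ⊤ := lt_top_iff_ne_top.2 hne
  obtain ⟨f, hf0, hf⟩ := Submodule.exists_dual_map_eq_bot_of_lt_top hlt inferInstance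
  -- the functional as a vector
  let w' : Fin n → ℚ := fun i => f (Pi.single i 1)
  have hfw : ∀ y : Fin n → ℚ, f y = y ⬝ᵥ w' := by
    intro y
    conv_lhs => rw [show y = ∑ i, y i • (Pi.single i 1 : Fin n → ℚ) from by
      funext j; simp [Finset.sum_apply, Pi.single_apply]]
    rw [map_sum]
    simp only [map_smul, smul_eq_mul, dotProduct, w']
  have hw'0 : w' ≠ 0 := by
    intro h0
    apply hf0
    apply LinearMap.ext
    intro y
    rw [hfw, h0, dotProduct_zero, LinearMap.zero_apply]
  have hperp : ∀ u ∈ dualInt v, qcast u ⬝ᵥ w' = 0 := by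
    intro u hu
    have : f (qcast u) ∈ (Submodule.span ℚ (qcast '' dualInt v)).map f :=
      Submodule.mem_map_of_mem (Submodule.subset_span ⟨u, hu, rfl⟩)
    rw [hf, Submodule.mem_bot, hfw] at this
    exact this
  -- scale `w'` to an integral `w ≠ 0`
  obtain ⟨N, hN, w, hw⟩ := exists_int_mul w'
  have hw0 : w ≠ 0 := by
    intro h0
    apply hw'0
    funext i
    have := hw i
    rw [h0, Pi.zero_apply, Int.cast_zero] at this
    have : (N : ℚ) * w' i = 0 := this.symm
    exact (mul_eq_zero.1 this).resolve_left (by exact_mod_cast hN.ne')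
  have hperpw : ∀ u ∈ dualInt v, u ⬝ᵥ w = 0 := by
    intro u hu
    have h1 : qcast u ⬝ᵥ qcast w = N * (qcast u ⬝ᵥ w') := by
      simp only [dotProduct, qcast, hw, Finset.mul_sum]
      refine Finset.sum_congr rfl fun i _ => by ring
    rw [hperp u hu, mul_zero, qcast_dotProduct] at h1
    exact_mod_cast h1
  -- both `w` and `-w` have a positive multiple in `S`
  obtain ⟨N₁, hN₁, h₁⟩ := exists_nsmul_mem_of_forall_dotProduct_nonneg v (w := w)
    (fun u hu => (hperpw u hu).symm.le)
  obtain ⟨N₂, hN₂, h₂⟩ := exists_nsmul_mem_of_forall_dotProduct_nonneg v (w := -w)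
    (fun u hu => by rw [dotProduct_neg, hperpw u hu, neg_zero])
  have hmem : (N₁ * N₂) • w ∈ AddSubmonoid.closure (Set.range v) := by
    rw [mul_comm, mul_nsmul']; exact AddSubmonoid.nsmul_mem _ h₁ _
  have hneg : -((N₁ * N₂) • w) ∈ AddSubmonoid.closure (Set.range v) := by
    rw [← smul_neg, mul_nsmul']; exact AddSubmonoid.nsmul_mem _ h₂ _
  have hzero := hsharp _ hmem hneg
  rw [smul_eq_zero] at hzero
  rcases hzero with h | h
  · exact absurd h (Nat.mul_ne_zero hN₁.ne' hN₂.ne')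
  · exact hw0 h

/-! ### The embedding -/

/-- **Embedding of a sharp monoid into `ℕⁿ`.** If `S = ⟨v₁,…,v_k⟩ ⊆ ℤⁿ` is sharp then there is
an additive `e : ℤⁿ → ℤⁿ`, injective, with `e(S) ⊆ ℕⁿ` (the coordinates are `n` linearly
independent integral vectors of the dual cone). [cite: Fulton1993Toric, §1.2] [cite: Kato1994, (9.8)] -/
theorem exists_embedding_of_sharp
    (hsharp : ∀ s ∈ AddSubmonoid.closure (Set.range v), -s ∈ AddSubmonoid.closure (Set.range v) → s = 0) :
    ∃ e : (Fin n → ℤ) →+ (Fin n → ℤ), Function.Injective e ∧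
      ∀ s ∈ AddSubmonoid.closure (Set.range v), ∀ i, 0 ≤ e s i := by
  classical
  -- a `ℚ`-basis of `ℚⁿ` inside `qcast '' dualInt v`
  obtain ⟨b, hbsub, hbspan, hbli⟩ := exists_linearIndependent ℚ (qcast '' dualInt v : Set (Fin n → ℚ))
  rw [span_dualInt_eq_top v hsharp] at hbspan
  have hbli' : LinearIndepOn ℚ id b := hbli
  have hbfin : b.Finite := hbli'.set_finite_of_isNoetherian
  haveI : Fintype b := hbfin.fintype
  have hcard : b.toFinset.card = n := by
    have h := finrank_span_set_eq_card (R := ℚ) (M := Fin n → ℚ) (s := b) hbli'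
    rw [hbspan, finrank_top] at h
    have h2 : Module.finrank ℚ (Fin n → ℚ) = n := Module.finrank_fin_fun ℚ
    rw [h2] at h
    exact h.symm
  have hcardb : Fintype.card b = n := (Set.toFinset_card b).symm.trans hcard
  -- integral representatives
  have hrep : ∀ y : b, ∃ u : Fin n → ℤ, u ∈ dualInt v ∧ qcast u = y := by
    intro y
    obtain ⟨u, hu, huy⟩ := hbsub y.2
    exact ⟨u, hu, huy⟩
  choose rep hrep_mem hrep_eq using hrep
  let idx : Fin n ≃ b := (Fintype.equivFinOfCardEq hcardb).symm
  let uvec : Fin n → (Fin n → ℤ) := fun i => rep (idx i)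
  refine ⟨{ toFun := fun z i => uvec i ⬝ᵥ z
            map_zero' := by funext i; exact dotProduct_zero _
            map_add' := fun z z' => by funext i; exact dotProduct_add _ _ _ }, ?_, ?_⟩
  · -- injectivity: the `uvec i` span `ℚⁿ`
    intro z z' h
    have hzz : ∀ i, uvec i ⬝ᵥ (z - z') = 0 := fun i => by
      have := congrFun h i
      simp only [AddMonoidHom.coe_mk, ZeroHom.coe_mk] at this
      rw [dotProduct_sub, this, sub_self]
    rw [← sub_eq_zero]
    set d := z - z' with hd
    -- every vector of `ℚⁿ` is orthogonal to `qcast d`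
    have hall : ∀ y ∈ Submodule.span ℚ b, y ⬝ᵥ qcast d = 0 := by
      intro y hy
      induction hy using Submodule.span_induction with
      | mem y hy =>
        have : y = qcast (uvec (idx.symm ⟨y, hy⟩)) := by
          simp only [uvec, Equiv.apply_symm_apply, hrep_eq]
        rw [this, qcast_dotProduct, hzz, Int.cast_zero]
      | zero => exact zero_dotProduct _
      | add y y' _ _ h1 h2 => rw [add_dotProduct, h1, h2, add_zero]
      | smul a y _ h1 => rw [smul_dotProduct, h1, smul_zero]
    funext i
    have h1 := hall (Pi.single i 1) (by rw [hbspan]; exact Submodule.mem_top)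
    rw [single_dotProduct, one_mul] at h1
    have h2 : ((d i : ℤ) : ℚ) = 0 := h1
    rw [Pi.zero_apply]
    exact_mod_cast h2
  · intro s hs i
    simp only [AddMonoidHom.coe_mk, ZeroHom.coe_mk]
    -- `uvec i ∈ dualInt v` pairs non-negatively with all of `S`
    induction hs using AddSubmonoid.closure_induction with
    | mem x hx => obtain ⟨j, rfl⟩ := hx; exact hrep_mem (idx i) j
    | zero => rw [dotProduct_zero]
    | add x y _ _ hx hy => rw [dotProduct_add]; exact add_nonneg hx hy

/-! ### Sharp embeddings of log charts exist -/

/-- **Existence of sharp embeddings** for a chart `P ⊆ ℤⁿ` (finitely generated, saturated) at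
a face `F`: the splitting `π` of `LogChartFaceSplitting` followed by the embedding of the sharp
monoid `π(P)` (`exists_embedding_of_sharp`). [cite: Kato1994, (9.8)] [cite: Fulton1993Toric, §1.2] -/
theorem exists_isSharpEmbedding {P F : AddSubmonoid (Fin n → ℤ)} (hP : P.FG) (h : IsFaceOf F P)
    (hsat : ∀ (v : Fin n → ℤ) (k : ℕ), 0 < k → k • v ∈ P → v ∈ P) :
    ∃ e : (Fin n → ℤ) →+ (Fin n → ℤ), IsSharpEmbedding P F e := by
  classical
  obtain ⟨π, hπ0, hπ1, -⟩ := h.exists_proj hsat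
  -- generators of the sharp monoid `π(P)`
  obtain ⟨T, hT⟩ := IsFaceOf.map_proj_fg (P := P) (π := π) hP
  let v : Fin T.card → (Fin n → ℤ) := fun i => (T.equivFin.symm i : Fin n → ℤ)
  have hS : AddSubmonoid.closure (Set.range v) = P.map π.toAddMonoidHom := by
    rw [← hT]
    congr 1
    ext x
    simp only [Set.mem_range, Finset.mem_coe, v]
    constructor
    · rintro ⟨i, rfl⟩; exact (T.equivFin.symm i).2
    · intro hx; exact ⟨T.equivFin ⟨x, hx⟩, by simp⟩
  have hsharp : ∀ s ∈ AddSubmonoid.closure (Set.range v),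
      -s ∈ AddSubmonoid.closure (Set.range v) → s = 0 := by
    intro s hs hns
    rw [hS] at hs hns
    obtain ⟨p, hp, rfl⟩ := AddSubmonoid.mem_map.1 hs
    obtain ⟨p', hp', hp'eq⟩ := AddSubmonoid.mem_map.1 hns
    refine h.sharp_map_proj hπ0 hπ1 hp hp' ?_
    have : π p' = -π p := hp'eq
    rw [this, add_neg_cancel]
  obtain ⟨e₀, he₀inj, he₀pos⟩ := exists_embedding_of_sharp v hsharp
  refine ⟨e₀.comp π.toAddMonoidHom, ⟨fun f hf => ?_, fun p hp i => ?_, fun p hp p' hp' hpp => ?_⟩⟩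
  · rw [AddMonoidHom.comp_apply, LinearMap.toAddMonoidHom_coe, hπ0 f (Submodule.subset_span hf),
      map_zero]
  · rw [AddMonoidHom.comp_apply, LinearMap.toAddMonoidHom_coe]
    exact he₀pos _ (hS ▸ ⟨p, hp, rfl⟩) i
  · have h1 : π p = π p' := he₀inj hpp
    have h2 : p - p' = (p - π p) - (p' - π p') := by rw [h1]; abel
    rw [h2]
    exact Submodule.sub_mem _ (hπ1 p) (hπ1 p')

/-- **Log regularity at a point in d-form — unconditional.** For a chart `φ : P → A` by a finitely
generated saturated `P ⊆ ℤⁿ`, log regular at the prime `𝔭` (Kato (2.1)), there are a sharp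
embedding `e : ℤⁿ → ℤⁿ`, a splitting `π`, and parameters `t₁..t_d ∈ 𝔪_{A_𝔭}` such that the
embedded chart `φ′ = embChart` is d-form chart data on `A_𝔭` (the hypotheses of the refinement
theorems `LogRegularCompleteStructure.isRegularLocalRing_localization_closedPoint_of_le`, `…_torusFibre`),
with `φ′(e p) = φ(p)·(unit)`. [cite: Kato1994, Def. (2.1)] -/
theorem exists_dformData_of_isLogRegularAt'' {A : Type u} [CommRing A]
    {P : AddSubmonoid (Fin n → ℤ)} (hP : P.FG)
    (hsat : ∀ (v : Fin n → ℤ) (k : ℕ), 0 < k → k • v ∈ P → v ∈ P)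
    {φ : Multiplicative P →* A} {𝔭 : Ideal A} [𝔭.IsPrime] (hreg : IsLogRegularAt P φ 𝔭) :
    ∃ (e : (Fin n → ℤ) →+ (Fin n → ℤ)) (he : IsSharpEmbedding P (faceMonoid P φ 𝔭) e)
      (π : (Fin n → ℤ) →ₗ[ℤ] (Fin n → ℤ)) (d : ℕ) (t : Fin d → Localization.AtPrime 𝔭),
      DFormData (embMonoid he) (embChart he π) d t ∧
      ∀ p : P, ∃ v : (Localization.AtPrime 𝔭)ˣ,
        embChart he π (embHom he p) * ↑v =
          algebraMap A (Localization.AtPrime 𝔭) (val P φ (p : Fin n → ℤ)) := by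
  obtain ⟨e, he⟩ := exists_isSharpEmbedding hP (isFaceOf_faceMonoid P φ 𝔭) hsat
  obtain ⟨π, d, t, hD, hc⟩ := exists_dformData_of_isLogRegularAt' hP hsat hreg he
  exact ⟨e, he, π, d, t, hD, hc⟩

end LogChart

end Literature.AlgebraicGeometry.Resolution
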